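import Summits.Ventures.PercRepro.SixFourResidueFourPlaneLineXbarB

/-!
# PercRepro — C-025 at `(6,4)`: the plane-line branch (γ) at `t = 4`, part 2C — Lemma X̄′, the count
(p5, gen 10; lead (nn))

The cardinalities of the four families of `SixFourResidueFourPlaneLineXbarB.lean` and the theorem

  **`Xcnt_le_planeLine`**: `X ≤ 2·(Σ_{C ∈ classes} 2^{|C|} + 2·n·#classes + 2·n) + 2·2^{n+e}·[two classes cover ρ]`

for every plane-line normalisation `D` of a rank-`4` set `G` of a simple matroid with every plane trace of
`≤ g − 3` points (`n = |L|`, `e = |ℓ ∩ ρ|`).  `card_famA_le`, `card_famC_le`, `card_famD_le`, `card_famB_le`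
(the covering pair is unique up to order, `card_coverPairs_le`), then `X = 2·#X₁′ + #X₁₂` (`card_Xset_eq`,
`card_X₂'_eq`) with `X₁′ ⊆ famA ∪ famC ∪ famD` and `X₁₂ ⊆ famB`.
-/

namespace PercRepro.SixFour

open Finset ThmH

variable {α : Type*} [DecidableEq α] {M : Matroid α} [M.Finite] {G : Finset α}

namespace PLData

variable {D : PLData M G}

/-- `#famA ≤ Σ_C 2^{|C|}`. -/
theorem card_famA_le : D.famA.card ≤ ∑ C ∈ D.classes, 2 ^ C.card := by
  unfold famA
  refine (Finset.card_biUnion_le).trans (Finset.sum_le_sum fun C _ => ?_)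
  exact Finset.card_image_le.trans (by rw [Finset.card_powerset])

/-- `|lamC C| ≤ 1` for a class `C`. -/
theorem card_lamC_le_one' (hs : Simple M) (hG : G ⊆ gr M) (h2 : 2 ≤ D.L.card)
    (hpl : ∀ P ∈ planes M, (P ∩ G).card + 3 ≤ G.card) {C : Finset α} (hC : C ∈ D.classes) :
    (D.lamC C).card ≤ 1 := by
  unfold lamC
  split_ifs with h
  · exact card_lamC_le_one hs hG h2 hpl hC h
  · simp

/-- `#famC ≤ 2·n·#classes`. -/
theorem card_famC_le (hs : Simple M) (hG : G ⊆ gr M) (h2 : 2 ≤ D.L.card)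
    (hpl : ∀ P ∈ planes M, (P ∩ G).card + 3 ≤ G.card) :
    D.famC.card ≤ 2 * D.L.card * D.classes.card := by
  unfold famC
  refine (Finset.card_biUnion_le).trans ?_
  have hC : ∀ C ∈ D.classes,
      (D.L.biUnion fun x => (D.lamC C).powerset.image fun W => D.L.erase x ∪ (C \ W)).card ≤
        2 * D.L.card := by
    intro C hC
    refine (Finset.card_biUnion_le).trans ?_
    have hx : ∀ x ∈ D.L, ((D.lamC C).powerset.image fun W => D.L.erase x ∪ (C \ W)).card ≤ 2 := by
      intro x _
      refine Finset.card_image_le.trans ?_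
      rw [Finset.card_powerset]
      have := card_lamC_le_one' hs hG h2 hpl hC
      calc 2 ^ (D.lamC C).card ≤ 2 ^ 1 := Nat.pow_le_pow_right (by norm_num) this
        _ = 2 := by norm_num
    calc ∑ x ∈ D.L, ((D.lamC C).powerset.image fun W => D.L.erase x ∪ (C \ W)).card ≤ ∑ _x ∈ D.L, 2 :=
          Finset.sum_le_sum hx
      _ = 2 * D.L.card := by rw [Finset.sum_const, smul_eq_mul, mul_comm]
  calc ∑ C ∈ D.classes,
        (D.L.biUnion fun x => (D.lamC C).powerset.image fun W => D.L.erase x ∪ (C \ W)).card ≤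
        ∑ _C ∈ D.classes, 2 * D.L.card := Finset.sum_le_sum hC
    _ = 2 * D.L.card * D.classes.card := by rw [Finset.sum_const, smul_eq_mul, mul_comm]

/-- `#famD ≤ 2·n`. -/
theorem card_famD_le (hs : Simple M) (hG : G ⊆ gr M) (h2 : 2 ≤ D.L.card) : D.famD.card ≤ 2 * D.L.card := by
  unfold famD
  refine (Finset.card_biUnion_le).trans ?_
  have hx : ∀ x ∈ D.L, ((D.ellF ∩ D.ρ).powerset.image fun T => D.L.erase x ∪ T).card ≤ 2 := by
    intro x _
    refine Finset.card_image_le.trans ?_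
    rw [Finset.card_powerset]
    have := card_ellF_inter_ρ_le_one (D := D) hs hG h2
    calc 2 ^ (D.ellF ∩ D.ρ).card ≤ 2 ^ 1 := Nat.pow_le_pow_right (by norm_num) this
      _ = 2 := by norm_num
  calc ∑ x ∈ D.L, ((D.ellF ∩ D.ρ).powerset.image fun T => D.L.erase x ∪ T).card ≤ ∑ _x ∈ D.L, 2 :=
        Finset.sum_le_sum hx
    _ = 2 * D.L.card := by rw [Finset.sum_const, smul_eq_mul, mul_comm]

/-- **A covering pair is unique up to order**: `#coverPairs ≤ 2·[∃ covering pair]`. -/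
theorem card_coverPairs_le (hs : Simple M) (hG : G ⊆ gr M) (h2 : 2 ≤ D.L.card) :
    D.coverPairs.card ≤ 2 * (if D.coverPairs.Nonempty then 1 else 0) := by
  split_ifs with hne
  · obtain ⟨⟨A, B⟩, hAB⟩ := hne
    unfold coverPairs at hAB
    rw [Finset.mem_filter, Finset.mem_product] at hAB
    obtain ⟨⟨hA, hB⟩, hne', hcov⟩ := hAB
    have hsub : D.coverPairs ⊆ {(A, B), (B, A)} := by
      intro q hq
      unfold coverPairs at hq
      rw [Finset.mem_filter, Finset.mem_product] at hq
      obtain ⟨⟨hq1, hq2⟩, hq12, -⟩ := hq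
      rw [Finset.mem_insert, Finset.mem_singleton]
      rcases classes_eq_of_cover hs hG h2 hA hB hcov hq1 with h1 | h1 <;>
        rcases classes_eq_of_cover hs hG h2 hA hB hcov hq2 with h2' | h2'
      · exact (hq12 (h1.trans h2'.symm)).elim
      · left; exact Prod.ext h1 h2'
      · right; exact Prod.ext h1 h2'
      · exact (hq12 (h1.trans h2'.symm)).elim
    calc D.coverPairs.card ≤ ({(A, B), (B, A)} : Finset (Finset α × Finset α)).card := Finset.card_le_card hsub
      _ ≤ 2 := Finset.card_le_two
      _ = 2 * 1 := by norm_num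
  · rw [Finset.not_nonempty_iff_eq_empty] at hne
    rw [hne, Finset.card_empty]

/-- `#famB ≤ 2·2^{n+e}·[∃ covering pair]`. -/
theorem card_famB_le (hs : Simple M) (hG : G ⊆ gr M) (h2 : 2 ≤ D.L.card) :
    D.famB.card ≤ 2 * 2 ^ (D.L.card + (D.ellF ∩ D.ρ).card) * (if D.coverPairs.Nonempty then 1 else 0) := by
  unfold famB
  refine (Finset.card_biUnion_le).trans ?_
  have hq : ∀ q ∈ D.coverPairs,
      ((D.L.powerset ×ˢ (q.1 ∩ q.2).powerset).image fun r => r.1 ∪ (D.ρ \ q.2) ∪ r.2).card ≤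
        2 ^ (D.L.card + (D.ellF ∩ D.ρ).card) := by
    intro q hq
    unfold coverPairs at hq
    rw [Finset.mem_filter, Finset.mem_product] at hq
    obtain ⟨⟨hq1, hq2⟩, hq12, -⟩ := hq
    refine Finset.card_image_le.trans ?_
    rw [Finset.card_product, Finset.card_powerset, Finset.card_powerset, ← pow_add]
    apply Nat.pow_le_pow_right (by norm_num)
    have : (q.1 ∩ q.2).card ≤ (D.ellF ∩ D.ρ).card :=
      Finset.card_le_card (classes_inter_subset hs hG h2 hq1 hq2 hq12)
    omega
  calc ∑ q ∈ D.coverPairs,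
        ((D.L.powerset ×ˢ (q.1 ∩ q.2).powerset).image fun r => r.1 ∪ (D.ρ \ q.2) ∪ r.2).card ≤
        ∑ _q ∈ D.coverPairs, 2 ^ (D.L.card + (D.ellF ∩ D.ρ).card) := Finset.sum_le_sum hq
    _ = D.coverPairs.card * 2 ^ (D.L.card + (D.ellF ∩ D.ρ).card) := by rw [Finset.sum_const, smul_eq_mul]
    _ ≤ (2 * (if D.coverPairs.Nonempty then 1 else 0)) * 2 ^ (D.L.card + (D.ellF ∩ D.ρ).card) :=
        Nat.mul_le_mul_right _ (card_coverPairs_le hs hG h2)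
    _ = 2 * 2 ^ (D.L.card + (D.ellF ∩ D.ρ).card) * (if D.coverPairs.Nonempty then 1 else 0) := by ring

/-- **LEMMA X̄′ WITHOUT A PLANE CAP** (mine-2's §21.18.4 (a), with the crude covering count of Lemma TW): for a
plane-line normalisation `D` of a rank-`4` set `G` of a simple matroid with every plane trace of `≤ g − 3` points,
`X ≤ 2·(Σ_{C ∈ classes} 2^{|C|} + 2·n·#classes + 2·n) + 2·2^{n+e}·[two classes cover ρ]`. -/
theorem Xcnt_le_planeLine (hs : Simple M) (hG : G ⊆ gr M) (hr : M.eRk (G : Set α) = 4)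
    (hpl : ∀ P ∈ planes M, (P ∩ G).card + 3 ≤ G.card) :
    Xcnt M G ≤ 2 * (∑ C ∈ D.classes, 2 ^ C.card + 2 * D.L.card * D.classes.card + 2 * D.L.card) +
      2 * 2 ^ (D.L.card + (D.ellF ∩ D.ρ).card) * (if D.coverPairs.Nonempty then 1 else 0) := by
  have h3 : 3 ≤ D.L.card := three_le_card_L' (D := D) (hpl _ D.plane)
  have h2 : 2 ≤ D.L.card := by omega
  have hX1 : D.X₁'.card ≤ ∑ C ∈ D.classes, 2 ^ C.card + 2 * D.L.card * D.classes.card + 2 * D.L.card := by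
    calc D.X₁'.card ≤ (D.famA ∪ D.famC ∪ D.famD).card := Finset.card_le_card (X₁'_subset hs hG hpl)
      _ ≤ (D.famA ∪ D.famC).card + D.famD.card := Finset.card_union_le _ _
      _ ≤ D.famA.card + D.famC.card + D.famD.card := by
          have := Finset.card_union_le D.famA D.famC
          omega
      _ ≤ ∑ C ∈ D.classes, 2 ^ C.card + 2 * D.L.card * D.classes.card + 2 * D.L.card := by
          have := card_famA_le (D := D)
          have := card_famC_le hs hG h2 hpl
          have := card_famD_le hs hG h2
          omega
  have hX12 : D.X₁₂.card ≤
      2 * 2 ^ (D.L.card + (D.ellF ∩ D.ρ).card) * (if D.coverPairs.Nonempty then 1 else 0) :=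
    (Finset.card_le_card (X₁₂_subset hs hG hr)).trans (card_famB_le hs hG h2)
  rw [card_Xset_eq h3, card_X₂'_eq]
  omega

end PLData

end PercRepro.SixFour
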